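import Summits.Ventures.PercRepro.CoreFourCounts
import Summits.Ventures.PercRepro.RankLevelSetCocircuitCount
import Summits.Ventures.PercRepro.RankLevelSetTriangleStar
import Summits.Ventures.PercRepro.CoreCountLarge

/-!
# PercRepro — the corank-`4` core cell of the `q = 3` row is kernel for `11 ≤ p ≤ 17` (p2, gen 12)

With `n = |E| = p + 4` and numbers `s₃ ≥ #{3-circuits}`, `s₄ ≥ #{4-circuits}`, `D₅ ≥ s₄·(|S₀| − 4)`, the counts of
`CoreFourCounts` give `#U(p,3) ≤ C(n,3) + s₃(n−3) + s₄`, `#{r ≤ 3} ≤ Σ_{j≤3} C(n,j) + s₃(n−3) + s₄ + D₅ + 1` and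
`#{spanning} ≤ Σ_{j≤4} C(n,j)`, so `Φ(p,3)·#U(p,3) ≤ #Y(p,3)` follows from the ONE inequality

  `Φ(p,3)·(C(n,3) + s₃(n−3) + s₄) + (Σ_{j≤3} C(n,j) + s₃(n−3) + s₄ + D₅ + 1) + Σ_{j≤4} C(n,j) ≤ 2^n`

with the EXACT `Φ(p,3) = (2^{p+3} − 2·Σ_{u≤3} C(p+3,u)) / C(p+3,3)` (the crude `2^{n−1}/C(n−1,3)` fails at `n = 15`).
On the core of the wrapper `ThmN.rls_succ_all` (simple, coloop-free, rank `p`, every element with an `e`-free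
partition) at corank `4` the tree supplies `s₃ ≤ 16` (`ThmN.ncard_triangles_le_sq`, (C1) from `RankLevelSetCoreSparse`)
and `s₄ ≤ 35` (the cocircuit count of `RankLevelSetCocircuitCount` on `S₀ = ⋃ {circuits ≤ 4}`, `|S₀| ≤ 16` by
Corollary N′, `ν(S₀) ≤ 4`), hence `D₅ ≤ 35·12`, and the seven cells `n = 15, …, 21` hold by kernel evaluation.
Together with `c025_corank_four_simple` (night-1, `|E| ≥ 100`) the corank-`4` residue of `SmallCoreCells''` shrinks to
`p ∈ {9, 10}` and `18 ≤ p ≤ 95`.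

* `cellOK4`, `cellOK4_spec` — the cell predicate (binomials as `descFactorial / factorial`) and its meaning;
* **`rls_of_cellOK4`** — a kernel-evaluated cell gives `ThmN.RLS M p 3` on the coloop-free core;
* `table_15_21` — the seven cells with `s₃ = 16`, `s₄ = 35`, `D₅ = 420`, by `decide +kernel`;
* `ncard_circuitsEq_three_le_sixteen`, `ncard_circuitsEq_four_le_thirtyfive` — `s₃ ≤ 16`, `s₄ ≤ 35` at corank `4`;
* **`c025_core_four`** — the cell `11 ≤ p ≤ 17`;
* `SmallCoreCells'''`, `smallCoreCells''_of`, **`c025_three_of_smallCoreCells'''`** — C-025 at `q = 3` on every finite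
  matroid from the remaining finite family of cells.
Imports `CoreFourCounts`, `RankLevelSetCocircuitCount`, `RankLevelSetTriangleStar`, `CoreCountLarge`. Axioms: standard.
-/

namespace PercRepro
namespace CoreFour

open Finset Set

/-! ### The cell predicate -/

/-- The corank-`4` cell at `n = |E|` with the bounds `s₃`, `s₄`, `D₅`: in `ℕ`, multiplied by `C(p+3,3)` (`p = n − 4`):
`phiNum·(C(n,3) + s₃(n−3) + s₄) + C(p+3,3)·(Σ_{j<4} C(n,j) + s₃(n−3) + s₄ + D₅ + 1 + Σ_{j<5} C(n,j)) ≤ C(p+3,3)·2ⁿ`,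
with `phiNum = 2^{p+3} − 2·Σ_{u<4} C(p+3,u) = Φ(p,3)·C(p+3,3)`. -/
def cellOK4 (n s₃ s₄ D₅ : ℕ) : Bool :=
  let p := n - 4
  let phiNum := 2 ^ (p + 3) - 2 * ∑ u ∈ range 4, CoreRegimes.chooseF (p + 3) u
  let phiDen := CoreRegimes.chooseF (p + 3) 3
  let U := CoreRegimes.chooseF n 3 + s₃ * (n - 3) + s₄
  let R := (∑ j ∈ range 4, CoreRegimes.chooseF n j) + s₃ * (n - 3) + s₄ + D₅ + 1
  let S := ∑ j ∈ range 5, CoreRegimes.chooseF n j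
  decide (phiNum * U + phiDen * (R + S) ≤ phiDen * 2 ^ n)

/-! ### From the cell to `RLS` -/

/-- The inequality behind `cellOK4`, in `ℕ` with ordinary binomials. -/
theorem cellOK4_spec {n s₃ s₄ D₅ : ℕ} (h : cellOK4 n s₃ s₄ D₅ = true) :
    (2 ^ (n - 4 + 3) - 2 * ∑ u ∈ range 4, Nat.choose (n - 4 + 3) u) * (n.choose 3 + s₃ * (n - 3) + s₄) +
      Nat.choose (n - 4 + 3) 3 * (((∑ j ∈ range 4, n.choose j) + s₃ * (n - 3) + s₄ + D₅ + 1) +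
        ∑ j ∈ range 5, n.choose j) ≤ Nat.choose (n - 4 + 3) 3 * 2 ^ n := by
  unfold cellOK4 at h
  simp only [CoreRegimes.chooseF_eq] at h
  exact of_decide_eq_true h

variable {α : Type} {M : Matroid α}

/-- **A kernel-evaluated corank-`4` cell gives C-025 at `(p, 3)` on the coloop-free core**: simple, (C1) lines of
`≤ 3` points, coloop-free, rank `p ≥ 9`, `|E| = p + 4`, and bounds `#{3-circuits} ≤ s₃`, `#{4-circuits} ≤ s₄`,
`#{4-circuits}·(|S₀| − 4) ≤ D₅`. -/
theorem rls_of_cellOK4 (M : Matroid α) [M.Finite] (p : ℕ) (hp : 9 ≤ p)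
    (hs : ∀ e ∈ M.E, ∀ f ∈ M.E, e ≠ f → M.eRk {e, f} = 2)
    (hC1 : ∀ L ⊆ M.E, M.eRk L = 2 → L.ncard ≤ 3) (hcoloop : ∀ e, ¬ M.IsColoop e)
    (hrank : M.eRank = (p : ℕ∞)) (hE : M.E.ncard = p + 4)
    {s₃ s₄ D₅ : ℕ} (hs₃ : (PercRepro.Matroid.circuitsEq M 3).ncard ≤ s₃)
    (hs₄ : (PercRepro.Matroid.circuitsEq M 4).ncard ≤ s₄)
    (hD₅ : (PercRepro.Matroid.circuitsEq M 4).ncard * ((⋃₀ PercRepro.Matroid.circuitsLE M 4).ncard - 4) ≤ D₅)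
    (hcell : cellOK4 (p + 4) s₃ s₄ D₅ = true) : ThmN.RLS M p 3 := by
  classical
  have hEcard : M.ground_finite.toFinset.card = p + 4 := by
    rw [← hE, Set.ncard_eq_toFinset_card _ M.ground_finite]
  have hd : M.E.encard = M.eRank + 4 := by
    rw [hrank, ← M.ground_finite.cast_ncard_eq, hE]; push_cast; rfl
  have hrank2 : 2 ≤ M.eRank := by rw [hrank]; exact_mod_cast (show 2 ≤ p by omega)
  have hn13 : 13 ≤ M.E.ncard := by omega
  -- (U)
  have hU : Matroid.topCount M p 3 ≤ (p + 4).choose 3 + s₃ * (p + 4 - 3) + s₄ := by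
    have h := topCount_le hs hrank2 hd hrank
    rw [hE] at h
    have h' : (PercRepro.Matroid.circuitsEq M 3).ncard * (p + 4 - 3) ≤ s₃ * (p + 4 - 3) :=
      Nat.mul_le_mul_right _ hs₃
    omega
  -- (R): the sets of rank `≤ 3`
  have hR : {X : Set α | X ⊆ M.E ∧ M.eRk X ≤ 3}.ncard ≤
      (∑ j ∈ range 4, (p + 4).choose j) + s₃ * (p + 4 - 3) + s₄ + D₅ + 1 := by
    have h := ncard_eRk_le_three_le hs hC1 hcoloop hrank2 hd hn13
    rw [hE] at h
    have h' : (PercRepro.Matroid.circuitsEq M 3).ncard * (p + 4 - 3) ≤ s₃ * (p + 4 - 3) :=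
      Nat.mul_le_mul_right _ hs₃
    omega
  -- (S): the spanning sets
  have hS : {X : Set α | X ⊆ M.E ∧ M.eRk X = M.eRank}.ncard ≤ ∑ j ∈ range 5, (p + 4).choose j := by
    have h := PercRepro.Matroid.ncard_spanning_le (M := M) (d := 4) hd
    rw [hEcard] at h
    exact h
  -- (Y): `2ⁿ ≤ #Y + #{r ≤ 3} + #{spanning}`
  have hY : 2 ^ (p + 4) ≤ Matroid.midCount M p 3 + {X : Set α | X ⊆ M.E ∧ M.eRk X ≤ 3}.ncard +
      {X : Set α | X ⊆ M.E ∧ M.eRk X = M.eRank}.ncard := by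
    have h := PercRepro.Matroid.two_pow_le_midCount_add (M := M) p 3 hrank
    rw [hEcard] at h
    exact h
  -- the cell, in `ℕ`
  have hcell' := cellOK4_spec hcell
  rw [Nat.add_sub_cancel] at hcell'
  -- names for the quantities
  obtain ⟨phiNum, hphiNum⟩ : ∃ x, x = 2 ^ (p + 3) - 2 * ∑ u ∈ range 4, Nat.choose (p + 3) u := ⟨_, rfl⟩
  obtain ⟨phiDen, hphiDen⟩ : ∃ x, x = Nat.choose (p + 3) 3 := ⟨_, rfl⟩
  obtain ⟨U, hU_def⟩ : ∃ x, x = (p + 4).choose 3 + s₃ * (p + 4 - 3) + s₄ := ⟨_, rfl⟩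
  obtain ⟨R, hR_def⟩ : ∃ x, x = (∑ j ∈ range 4, (p + 4).choose j) + s₃ * (p + 4 - 3) + s₄ + D₅ + 1 := ⟨_, rfl⟩
  obtain ⟨S, hS_def⟩ : ∃ x, x = ∑ j ∈ range 5, (p + 4).choose j := ⟨_, rfl⟩
  rw [← hphiNum, ← hphiDen, ← hU_def, ← hR_def, ← hS_def] at hcell'
  rw [← hU_def] at hU
  rw [← hR_def] at hR
  rw [← hS_def] at hS
  -- to `ℚ`
  have hUq : (Matroid.topCount M p 3 : ℚ) ≤ (U : ℚ) := by exact_mod_cast hU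
  have hRq : ({X : Set α | X ⊆ M.E ∧ M.eRk X ≤ 3}.ncard : ℚ) ≤ (R : ℚ) := by exact_mod_cast hR
  have hSq : ({X : Set α | X ⊆ M.E ∧ M.eRk X = M.eRank}.ncard : ℚ) ≤ (S : ℚ) := by exact_mod_cast hS
  have hYq : ((2 : ℕ) ^ (p + 4) : ℚ) ≤ (Matroid.midCount M p 3 : ℚ) +
      ({X : Set α | X ⊆ M.E ∧ M.eRk X ≤ 3}.ncard : ℚ) +
      ({X : Set α | X ⊆ M.E ∧ M.eRk X = M.eRank}.ncard : ℚ) := by exact_mod_cast hY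
  have hcellq : (phiNum : ℚ) * (U : ℚ) + (phiDen : ℚ) * ((R : ℚ) + (S : ℚ)) ≤
      (phiDen : ℚ) * ((2 : ℕ) ^ (p + 4) : ℚ) := by exact_mod_cast hcell'
  have hsub : 2 * ∑ u ∈ range 4, Nat.choose (p + 3) u ≤ 2 ^ (p + 3) := by
    have := CoreRegimes.sum_Ioo_choose_add p (by omega); omega
  have hphi : phiK p 3 * (phiDen : ℚ) = (phiNum : ℚ) := by
    rw [hphiNum, Nat.cast_sub hsub, hphiDen]
    push_cast
    exact CoreRegimes.phiK_three_mul_choose_eq p (by omega)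
  have hDpos : (0 : ℚ) < (phiDen : ℚ) := by
    rw [hphiDen]; exact_mod_cast Nat.choose_pos (by omega)
  have hNnn : (0 : ℚ) ≤ (phiNum : ℚ) := by positivity
  have h1 : (phiNum : ℚ) * (Matroid.topCount M p 3 : ℚ) ≤ (phiNum : ℚ) * (U : ℚ) :=
    mul_le_mul_of_nonneg_left hUq hNnn
  have h2 : (phiDen : ℚ) * ((2 : ℕ) ^ (p + 4) : ℚ) ≤
      (phiDen : ℚ) * ((Matroid.midCount M p 3 : ℚ) + (R : ℚ) + (S : ℚ)) :=
    mul_le_mul_of_nonneg_left (by linarith) hDpos.le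
  have hkey : (phiNum : ℚ) * (Matroid.topCount M p 3 : ℚ) ≤ (phiDen : ℚ) * (Matroid.midCount M p 3 : ℚ) := by
    nlinarith [h1, h2, hcellq]
  rw [ThmN.RLS_iff]
  rw [← hphi] at hkey
  have : phiK p 3 * (Matroid.topCount M p 3 : ℚ) * (phiDen : ℚ) ≤ (Matroid.midCount M p 3 : ℚ) * (phiDen : ℚ) := by
    calc phiK p 3 * (Matroid.topCount M p 3 : ℚ) * (phiDen : ℚ)
        = phiK p 3 * (phiDen : ℚ) * (Matroid.topCount M p 3 : ℚ) := by ring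
      _ ≤ (phiDen : ℚ) * (Matroid.midCount M p 3 : ℚ) := hkey
      _ = (Matroid.midCount M p 3 : ℚ) * (phiDen : ℚ) := by ring
  exact le_of_mul_le_mul_right this hDpos

/-! ### The cells `15 ≤ n ≤ 21` with `s₃ = 16`, `s₄ = 35`, `D₅ = 420` -/

/-- The seven cells `n = 15, …, 21` (`p = 11, …, 17`) with the tree's bounds `s₃ ≤ 16`, `s₄ ≤ 35`, `D₅ ≤ 35·12`,
by kernel evaluation (exact ratios `0.98, 0.96, 0.90, 0.85, 0.81, 0.78, 0.75` of `2ⁿ`). -/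
theorem table_15_21 : ∀ n < 22, 15 ≤ n → cellOK4 n 16 35 420 = true := by
  decide +kernel


/-- **`s₃ ≤ 16` at corank `4`** under (C1) (`ThmN.ncard_triangles_le_sq` with `d = 4`). -/
theorem ncard_circuitsEq_three_le_sixteen [M.Finite] (hC1 : ∀ L ⊆ M.E, M.eRk L = 2 → L.ncard ≤ 3)
    (hd : M.E.encard = M.eRank + 4) : (PercRepro.Matroid.circuitsEq M 3).ncard ≤ 16 := by
  have h := ThmN.ncard_triangles_le_sq M hC1 hd
  exact h

/-- `S₀ = ⋃ {circuits with ≤ 4 elements}` at corank `4`: at most `16` elements (Corollary N′). -/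
theorem ncard_sUnion_circuitsLE_four_le [M.Finite] (hd : M.E.encard = M.eRank + 4) :
    (⋃₀ PercRepro.Matroid.circuitsLE M 4).ncard ≤ 16 := by
  have hfin : (⋃₀ PercRepro.Matroid.circuitsLE M 4).Finite :=
    M.ground_finite.subset (sUnion_circuitsLE_subset_ground M 4)
  have h := PercRepro.Matroid.encard_sUnion_circuitsLE_le (M := M) (k := 4) (d := 4) hd
  rw [← hfin.cast_ncard_eq] at h
  exact_mod_cast h

/-- **`s₄ ≤ 35` at corank `4`**: the cocircuit count on `S₀` (`|S₀| ≤ 16`, `ν(S₀) ≤ 4`). -/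
theorem ncard_circuitsEq_four_le_thirtyfive [M.Finite] (hd : M.E.encard = M.eRank + 4) :
    (PercRepro.Matroid.circuitsEq M 4).ncard ≤ 35 := by
  have hS₀E : ⋃₀ PercRepro.Matroid.circuitsLE M 4 ⊆ M.E := sUnion_circuitsLE_subset_ground M 4
  have hcov : ∀ C, M.IsCircuit C → C.ncard = 4 → C ⊆ ⋃₀ PercRepro.Matroid.circuitsLE M 4 :=
    fun C hC h4 => subset_sUnion_of_mem_circuitsEq_four ⟨hC, h4⟩
  have h := PercRepro.Matroid.ncard_isCircuit_four_le_of_subset_nullity_le_four M hS₀E hcov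
    (ncard_sUnion_circuitsLE_four_le hd) (encard_le_eRk_add_of_ground hS₀E hd)
  exact h

/-- **C-025 at `(p, 3)` on the coloop-free core at corank `4`, for every `11 ≤ p ≤ 17`.** -/
theorem c025_core_four (M : Matroid α) [M.Finite] (p : ℕ) (hp : 11 ≤ p) (hp' : p ≤ 17)
    (hs : ∀ e ∈ M.E, ∀ f ∈ M.E, e ≠ f → M.eRk {e, f} = 2) (hcoloop : ∀ e, ¬ M.IsColoop e)
    (hfree : ∀ e ∈ M.E, ∃ A ⊆ M.E \ {e}, e ∉ M.closure A ∧ e ∉ M.closure ((M.E \ {e}) \ A))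
    (hrank : M.eRank = (p : ℕ∞)) (hE : M.E.ncard = p + 4) : ThmN.RLS M p 3 := by
  have hC1 : ∀ L ⊆ M.E, M.eRk L = 2 → L.ncard ≤ 3 :=
    fun L hL hr => ThmN.ncard_le_three_of_eRk_two M hs hfree hL hr
  have hd : M.E.encard = M.eRank + 4 := by
    rw [hrank, ← M.ground_finite.cast_ncard_eq, hE]; push_cast; rfl
  have hs₃ := ncard_circuitsEq_three_le_sixteen hC1 hd
  have hs₄ := ncard_circuitsEq_four_le_thirtyfive hd
  have hD₅ : (PercRepro.Matroid.circuitsEq M 4).ncard * ((⋃₀ PercRepro.Matroid.circuitsLE M 4).ncard - 4) ≤ 420 := by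
    have h16 := ncard_sUnion_circuitsLE_four_le hd
    calc (PercRepro.Matroid.circuitsEq M 4).ncard * ((⋃₀ PercRepro.Matroid.circuitsLE M 4).ncard - 4)
        ≤ 35 * 12 := Nat.mul_le_mul hs₄ (by omega)
      _ = 420 := by norm_num
  exact rls_of_cellOK4 M p (by omega) hs hC1 hcoloop hrank hE hs₃ hs₄ hD₅
    (table_15_21 (p + 4) (by omega) (by omega))

/-! ### The remaining cells -/

/-- **The small core cells after the corank-`4` cell `11 ≤ p ≤ 17`**: `p ∈ {7, 8}`, or `9 ≤ p ≤ 169` with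
`p + 4 ≤ |E| < p + amin p`, the corank-`4` cells only for `p ∈ {9, 10}` and `18 ≤ p ≤ 95`. -/
def SmallCoreCells''' : Prop :=
  ∀ {α : Type} (M : Matroid α) [M.Finite] (p : ℕ), 5 ≤ p →
    (∀ e ∈ M.E, ∀ f ∈ M.E, e ≠ f → M.eRk {e, f} = 2) → M.eRank = (p : ℕ∞) →
    (∀ e, ¬ M.IsColoop e) →
    (∀ e ∈ M.E, ∃ A ⊆ M.E \ {e}, e ∉ M.closure A ∧ e ∉ M.closure ((M.E \ {e}) \ A)) →
    ((p = 7 ∨ p = 8) ∨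
      (p ≤ 169 ∧ p + 4 ≤ M.E.ncard ∧ M.E.ncard < p + CoreRegimes.amin p ∧
        ¬ (M.E.ncard = p + 4 ∧ 100 ≤ M.E.ncard) ∧ ¬ (M.E.ncard = p + 4 ∧ 11 ≤ p ∧ p ≤ 17))) →
    ThmN.RLS M p 3

/-- The cells of `SmallCoreCells''` outside `SmallCoreCells'''` are the corank-`4` cells `11 ≤ p ≤ 17`
(`c025_core_four`). -/
theorem smallCoreCells''_of (h : SmallCoreCells''') : CoreCount.SmallCoreCells'' := by
  intro α M _ p hp hs hrank hcoloop hfree hcell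
  rcases hcell with h78 | ⟨hp169, hlo, hhi, h4⟩
  · exact h M p hp hs hrank hcoloop hfree (Or.inl h78)
  · by_cases hmid : M.E.ncard = p + 4 ∧ 11 ≤ p ∧ p ≤ 17
    · exact c025_core_four M p hmid.2.1 hmid.2.2 hs hcoloop hfree hrank hmid.1
    · exact h M p hp hs hrank hcoloop hfree (Or.inr ⟨hp169, hlo, hhi, h4, hmid⟩)

/-- **C-025 at `q = 3` for every finite matroid and every `p ≥ 5`, from the remaining small core cells.** -/
theorem c025_three_of_smallCoreCells''' (h : SmallCoreCells''') :
    ∀ {α : Type} (M : Matroid α) [M.Finite] (p : ℕ), 5 ≤ p → ThmN.RLS M p 3 :=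
  CoreCount.c025_three_of_smallCoreCells'' (smallCoreCells''_of h)

end CoreFour
end PercRepro
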